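import Summits.AtomisticToContinuum.HydrodynamicLimit.Theses.OneFlightGossipEngine
import Summits.AtomisticToContinuum.HydrodynamicLimit.Theorems.OneFlightGossipEngineCollisionActivityTailsAbnormalActivityTagged
import Summits.AtomisticToContinuum.HydrodynamicLimit.Theorems.OneFlightGossipEngineCollisionActivityTailsAbnormalActivityHot
import Summits.AtomisticToContinuum.HydrodynamicLimit.Theorems.OneFlightGossipEngineCollisionActivityTailsEnvelopePlumbing
import Summits.AtomisticToContinuum.HydrodynamicLimit.Theorems.OneFlightGossipEngineCollisionActivityTailsLMGFOfJointTails
import Summits.AtomisticToContinuum.HydrodynamicLimit.Theorems.JParityClosureOddContactSymmetryGibbsInvariance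
import Literature.MathematicalPhysics.KineticTheory.HardSphereCampbellWindows
import HarnessLib

/-!
# Skeleton of line `plaque-thinning-count-ld` for the crux `CollisionActivityTails` (stmt-AtomisticToContinuum-13734) — lead's reshape v12 (cycle 3, lead c7-0)

Crux decl (concluded BY NAME by `CollisionActivityTails_of`):
`Summit.AtomisticToContinuum.HydrodynamicLimit.Theses.OneFlightGossipEngine.CollisionActivityTails`.

## The line in one paragraph (unchanged mechanism, TWO tagging thresholds)

The window activity `a_i = (σ/τ) Σ_{collisions of i} |Δv_i|` is split COLLISION BY COLLISION into `hotAct Θ` (relative speed `> Θ`),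
`tagAct₂ Θ yc yk K` (cold collisions while `i` is TAGGED: at some scale `K' ≥ max K 1` the ball of mean occupancy `K'` around `i` holds
`≥ yc K'` centres OR kinetic energy `≥ yk K'`) and `uncAct₂ Θ yc yk K` (cold, untagged: the recurrent branch). `a = unc + tag + hot` on
the good set, so `𝟙{V<a}a ≤ 3(𝟙{V/3<unc}unc + tag + hot)` and the crux follows (`crux_of_branches`, PROVED) from
* `UntaggedActivityTails₂'` ⟸ (entropy inequality at time zero, stub ET₂) `EquilibriumUntaggedActivityLMGF₂'` ⟸ (`lmgf_assembly`, PROVED,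
  over the landed generic lemma p137153, measurability M₂ and the start shift, PROVED here) the OPEN N1-type input
  `EquilibriumJointUntaggedTail₂` (2j₂), and
* `AbnormalActivityVanishes₂'` ⟸ (hot half LANDED p132340 + tagged half T₂a/T₂b + reduction, PROVED here) the import
  `PreShockEnvelopeDilute₂` (4''), whose diluteness clause is `C (2π/β)^{3/2} σ³ ≤ κ` — WITHOUT the factor `max 1 β⁻¹` of v4–v11.

## Why v12 (cycle 3): decouple the count threshold from the kinetic threshold

In v4–v11 ONE threshold `y` served both the count tag (`nearCount ≥ yK'`) and the kinetic tag (`ballKinetic ≥ yK'`). The untagged branch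
needs the dense-phase guard `y σ³ ≤ 1` (count-tagging is void above close packing, audit cycle 1), while the tagged branch needs, under an
envelope `C^k e^{-βE_k}`, `y ≥ 100 A` for the count series and `y ≥ 200 A β⁻¹` for the kinetic series (`A = C(2π/β)^{3/2}`; landed
`count_decay` / `kinetic_decay`, p134886). Coupling the two forced the import's clause `A σ³ max(1, β⁻¹) ≤ κ`: a demand of bounded HEATING
(`β⁻¹ ≍ θ_max(t)`) on top of bounded compression. With two thresholds the count threshold `yc` alone carries the guard (`yc σ³ ≤ 1`,
delivered as `yc := 100 A`, so the clause is `A σ³ ≤ 1/100`), and the kinetic threshold `yk := 200 A β⁻¹` is free — the untagged branch's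
level `V₀(yc, yk)` may depend on it (it is chosen after `t`). Hard spheres have no energy scale; the temperature factor was an artefact.
Consequences: (i) the import 4'' is WEAKER than 4' (strictly, for heated data); (ii) under the conjunct's packing guard `ρσ³ < η₀` and a
LOCAL pre-shock envelope `A^k ∏ ρ(r,x_i) M_{λθ(r,x_i),u(r,x_i)}(v_i)` (the strategist's N2 child `PreShockLocalEnvelope`), the count series
sees only the spatial constant `A ρ_max σ³ < A η₀` and the kinetic/hot series accept any Gaussian domination — so the GUARDED crux closes
from N1 + N2-local WITHOUT localising the tags (cycle-3 architecture note `ARCHITECTURE-v12.md`, crux evidence); the dense/imploding corner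
of the UNGUARDED crux is isolated in the clause of 4'' (= "the solution stays `κ/A`-dilute on `[0,t]`", the content of the conjunct's guard).

## Reshape log (earlier entries: tree `Lines/plaque_thinning_count_ld.lean` history, line card `Lines/plaque-thinning-count-ld.md`)
* cycle 1 (a1-0): stub 1 ratio typing false (chains) → instantaneous aiming supermartingale; v4 dense-phase guard `yσ³ ≤ 1`, import 4'
  with dilute β-aware constants; stub 5 re-typed locally and PROVED (p132340 p135296 p132104 p131788 …).
* cycle 2 (c6-0): stub 2 audited (not statics) → v10/v11: LMGF assembled from 2m/2s/2g (landed p137046 p136939 p137153) + OPEN 2j;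
  equilibrium rung from 2j alone (p136703 p137111 p142075); cold-regime certificate p137332; outcome promote-stub 2j.
* cycle 3 (c7-0), v12: two thresholds (this file). Registered stubs: M₂ `stub_uncActMeasurableTT`, ET₂ `stub_entropyTransferTT`,
  T₂a `stub_taggedPerPairTT`, T₂b `stub_taggedFromLabelEnvelopeTT`, R₂ `stub_equilibriumRungTT` (helper rung), MB `stub_equilibriumMeanActivity`
  (helper rung) — all closable ports of landed one-threshold files; OPEN inputs `stub_jointUntaggedTailTT` (2j₂, N1) and
  `stub_preShockEnvelopeDiluteTT` (4'', import). PROVED here: start shift, abnormal reduction, LMGF assembly, composition.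
-/

noncomputable section

open MeasureTheory Set Filter Topology
open scoped ENNReal

namespace Summit.AtomisticToContinuum.HydrodynamicLimit.Cruxes.CollisionActivityTails.PlaqueThinningCountLd

open Literature.MathematicalPhysics.KineticTheory Literature.Analysis.FluidPDE
open Summit.AtomisticToContinuum.HydrodynamicLimit.Theorems.CollisionActivityTailsActivityDomination
  (Flow Cfg window act tdist nearCount collisionPairSum_nonneg window_pos)
open Summit.AtomisticToContinuum.HydrodynamicLimit.Theorems.CollisionActivityTailsNearFieldKineticTails
  (tailFn tailFn_of_lt tailFn_of_le tailFn_nonneg)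
open Summit.AtomisticToContinuum.HydrodynamicLimit.Theorems.CollisionActivityTailsEndpointTails (ae_mem_good_localGibbsLaw)
open Summit.AtomisticToContinuum.HydrodynamicLimit.Theorems.CollisionActivityTailsEnvelopePlumbing
  (LabelLawEnvelope LabelEnvelopeOn LabelEnvelopeFromEnvelope stub_labelEnvelopeOn)
open Summit.AtomisticToContinuum.HydrodynamicLimit.Theorems.CollisionActivityTailsAbnormalActivity
  (rec imp relSpeed scaleRadius ballKinetic hotAct EnvelopeOn HotSmallOn HotFromEnvelope imp_le_relSpeed
    hotFromEnvelope_of_pairEnvelope)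
open Summit.AtomisticToContinuum.HydrodynamicLimit.Theorems.CollisionActivityTailsAbnormalActivityTagged (tubePair fluxJ)

/-! ## §0 Vocabulary (two thresholds; `rec`, `imp`, `relSpeed`, `scaleRadius`, `ballKinetic`, `hotAct`, `EnvelopeOn` are the landed
copies of `…Theorems.CollisionActivityTailsAbnormalActivity`) -/

variable {σ : ℝ} {N : ℕ}

/-- The global Gibbs law (constant activity `a₀`, zero drift, temperature `θ₀`) — the equilibrium reference `G_N`. -/
def gibbs (σ a₀ θ₀ : ℝ) (N : ℕ) (Φ : Flow σ N) : Measure (Cfg N) :=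
  localGibbsLaw σ (fun _ => a₀) (fun _ => 0) (fun _ => θ₀) N Φ

/-- Particle `i` is **tagged with two thresholds** (count threshold `yc`, kinetic threshold `yk`, minimal scale `K`) in the
configuration `cfg`: at some scale `K' ≥ max K 1` the ball of mean occupancy `K'` around `i` holds at least `yc K'` centres OR kinetic
energy (twice) at least `yk K'`. `Tagged y K` of v4–v11 is the diagonal `yc = yk = y` (definitionally). -/
def Tagged₂ (yc yk : ℝ) (K : ℕ) (cfg : Cfg N) (i : Fin (N + 1)) : Prop :=
  ∃ K' : ℕ, K ≤ K' ∧ 1 ≤ K' ∧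
    (yc * K' ≤ (nearCount cfg i (scaleRadius N K') : ℝ) ∨ yk * K' ≤ ballKinetic cfg i (scaleRadius N K'))

open scoped Classical in
/-- **Untagged cold activity** `uncAct₂`: `(σ/τ) Σ |Δv_i|` over the collisions of `i` in `(s, s+w]` with relative speed `≤ Θ` at which
`i` is NOT tagged (two thresholds) — the recurrent branch. -/
def uncAct₂ (Θ yc yk : ℝ) (K : ℕ) (Φ : Flow σ N) (τ s : ℝ) (i : Fin (N + 1)) (z : Cfg N) : ℝ :=
  σ / τ * Φ.collisionPairSum (Set.Ioc s (s + window τ N))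
    (fun t cfg k l => if k = i ∧ relSpeed cfg k l ≤ Θ ∧ ¬ Tagged₂ yc yk K cfg i then imp σ N cfg t k l else 0) z

open scoped Classical in
/-- **Tagged cold activity** `tagAct₂`: cold collisions of `i` at which `i` IS tagged (two thresholds). -/
def tagAct₂ (Θ yc yk : ℝ) (K : ℕ) (Φ : Flow σ N) (τ s : ℝ) (i : Fin (N + 1)) (z : Cfg N) : ℝ :=
  σ / τ * Φ.collisionPairSum (Set.Ioc s (s + window τ N))
    (fun t cfg k l => if k = i ∧ relSpeed cfg k l ≤ Θ ∧ Tagged₂ yc yk K cfg i then imp σ N cfg t k l else 0) z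

/-- The count-or-kinetic tag at scale `K'` with two thresholds and the radius ENLARGED by `δ` (read at the grid time). -/
def ScaleTag₂ (yc yk δ : ℝ) (K' : ℕ) (w : Cfg N) (k : Fin (N + 1)) : Prop :=
  yc * K' ≤ (nearCount w k (scaleRadius N K' + δ) : ℝ) ∨ yk * K' ≤ ballKinetic w k (scaleRadius N K' + δ)

/-- ENLARGED TAGGING (two thresholds) from the minimal scale `K`: some scale `K + j` carries the enlarged tag. -/
def TaggedPlus₂ (yc yk δ : ℝ) (K : ℕ) (w : Cfg N) (k : Fin (N + 1)) : Prop := ∃ j : ℕ, ScaleTag₂ yc yk δ (K + j) w k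

/-! ## §1 The statements -/

/-- **STUB M₂ — MEASURABILITY OF THE UNTAGGED COLD ACTIVITY** (closable port of p137046 with two thresholds): the untagged activity,
extended by `0` off the good set, is measurable in the initial datum. -/
def UncActMeasurable₂ : Prop :=
  ∀ (σ : ℝ) (N : ℕ) (Φ : Flow σ N) (Θ yc yk : ℝ) (K : ℕ) (τ s : ℝ) (i : Fin (N + 1)),
    Measurable (Φ.good.indicator fun z => uncAct₂ Θ yc yk K Φ τ s i z)

/-- **START SHIFT** (proved below, as p136939): the untagged activity over `(s, s + w]` of the orbit of a good datum `z` is the untagged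
activity over `(0, w]` of the orbit of `Φ_s z`. -/
def UncActShift₂ : Prop :=
  ∀ (σ : ℝ) (N : ℕ) (Φ : Flow σ N) (Θ yc yk : ℝ) (K : ℕ) (τ s : ℝ) (i : Fin (N + 1)) (z : Cfg N),
    z ∈ Φ.good → uncAct₂ Θ yc yk K Φ τ s i z = uncAct₂ Θ yc yk K Φ τ 0 i (Φ.flow s z)

/-- The generic exponential-moment-from-joint-tails lemma (VERBATIM the landed `LMGFOfJointTails`, p137153). -/
def LMGFOfJointTails : Prop :=
  ∀ (α : Type) [MeasurableSpace α] (μ : Measure α) [IsProbabilityMeasure μ] (n : ℕ) (F : Fin n → α → ℝ),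
    (∀ i, AEMeasurable (F i) μ) →
    ∀ (V p r γ : ℝ), 0 ≤ p → 0 < γ → γ < r →
    (∀ (S : Finset (Fin n)) (m : Fin n → ℕ),
      μ {z | ∀ i ∈ S, V + (m i : ℝ) < F i z} ≤
        ENNReal.ofReal (∏ i ∈ S, p * Real.exp (-(r * (V + (m i : ℝ)))))) →
    ∫⁻ z, ENNReal.ofReal (Real.exp (γ * ∑ i, tailFn V (F i z))) ∂μ ≤
      ENNReal.ofReal (Real.exp ((n : ℝ) *
        (p * Real.exp γ * Real.exp (-((r - γ) * V)) / (1 - Real.exp (-(r - γ))))))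

/-- **STUB 2j₂ — EQUILIBRIUM JOINT UNTAGGED TAIL, two thresholds** (the dynamical heart of the recurrent branch; OPEN, N1-type).
Under the global Gibbs law, window `(0, τℓ_N]`: for a count threshold `yc` with the dense-phase guard `yc σ³ ≤ 1` and ANY kinetic
threshold `yk` there is a level `V₀(a₀, θ₀, σ, yc, yk)` such that for every cold cap `Θ`, every minimal tagging scale `K`, some prefactor
`p ≥ 0`, EVERY rate `r > 0`, all `τ ≥ τ₀(r)`, `N ≥ N₀`, every flow, every label set `S` and every grid of levels `V + m_i ≥ V₀`:
`G_N(∀ i ∈ S, uncAct₂_i > V + m_i) ≤ ∏_{i∈S} p e^{-r (V + m_i)}`. Same plausibility and attack surface as the promoted 2j (PROMOTE.md v5;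
edmd-2j.md): rate `∝ τ` at fixed level, product form across labels; the guard and `V₀(yc, yk)` are load-bearing (cold close-packed
droplets resp. hot blobs at scales `≥ K` are tagged; sub-scale clusters explode within `≍ εK^{1/3}/√θ ≪ τℓ`). -/
def EquilibriumJointUntaggedTail₂ : Prop :=
  ∀ (a₀ θ₀ : ℝ), 0 < a₀ → 0 < θ₀ → ∃ σ₀ : ℝ, 0 < σ₀ ∧ ∀ σ : ℝ, 0 < σ → σ < σ₀ →
    ∀ yc : ℝ, 0 < yc → yc * σ ^ 3 ≤ 1 → ∀ yk : ℝ, 0 < yk → ∃ V₀ : ℝ, 0 < V₀ ∧ ∀ Θ : ℝ, 0 < Θ → ∀ K : ℕ,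
    ∃ p : ℝ, 0 ≤ p ∧ ∀ r : ℝ, 0 < r → ∃ τ₀ : ℝ, 0 < τ₀ ∧ ∀ τ : ℝ, τ₀ ≤ τ → ∃ N₀ : ℕ, ∀ N : ℕ, N₀ ≤ N →
    ∀ (Φ : Flow σ N) (S : Finset (Fin (N + 1))) (m : Fin (N + 1) → ℕ) (V : ℝ), V₀ ≤ V →
      gibbs σ a₀ θ₀ N Φ {z | ∀ i ∈ S, V + (m i : ℝ) < uncAct₂ Θ yc yk K Φ τ 0 i z} ≤
        ENNReal.ofReal (∏ i ∈ S, p * Real.exp (-(r * (V + (m i : ℝ)))))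

/-- **The untagged LMGF, two thresholds** (`∀ yc`, `yc σ³ ≤ 1`, `∀ yk`, `∃ V₀`; otherwise verbatim `EquilibriumUntaggedActivityLMGF'`):
under `G_N`, the exponential moment at every tilt `γ` of the SUM of the untagged-activity tails has pressure `≤ δ` once `τ ≥ τ₀(γ, δ)`. -/
def EquilibriumUntaggedActivityLMGF₂' : Prop :=
  ∀ (a₀ θ₀ : ℝ), 0 < a₀ → 0 < θ₀ → ∃ σ₀ : ℝ, 0 < σ₀ ∧ ∀ σ : ℝ, 0 < σ → σ < σ₀ →
    ∀ yc : ℝ, 0 < yc → yc * σ ^ 3 ≤ 1 → ∀ yk : ℝ, 0 < yk → ∃ V₀ : ℝ, 0 < V₀ ∧ ∀ V : ℝ, V₀ ≤ V → ∀ Θ : ℝ, 0 < Θ → ∀ K : ℕ,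
    ∀ γ : ℝ, 0 < γ → ∀ δ : ℝ, 0 < δ → ∃ τ₀ : ℝ, 0 < τ₀ ∧ ∀ τ : ℝ, τ₀ ≤ τ → ∃ N₀ : ℕ, ∀ N : ℕ, N₀ ≤ N →
    ∀ (Φ : Flow σ N) (s : ℝ), 0 ≤ s →
      AEMeasurable (fun z => ∑ i : Fin (N + 1), tailFn V (uncAct₂ Θ yc yk K Φ τ s i z)) (gibbs σ a₀ θ₀ N Φ) ∧
      ∫⁻ z, ENNReal.ofReal (Real.exp (γ * ∑ i : Fin (N + 1), tailFn V (uncAct₂ Θ yc yk K Φ τ s i z)))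
          ∂(gibbs σ a₀ θ₀ N Φ) ≤ ENNReal.ofReal (Real.exp (δ * ((N : ℝ) + 1)))

/-- **The untagged tail statement under the TRUE law, two thresholds** (crux frame; `∀ t < T ∀ yc (yc σ³ ≤ 1) ∀ yk ∃ V₀ ∀ V ∀ Θ ∀ K ∀ η
∃ τ₀ ∀ τ ∃ N₀ ∀ N ∀ s ≤ t`; otherwise verbatim `UntaggedActivityTails'`). -/
def UntaggedActivityTails₂' : Prop :=
  ∀ (a₀ θ₀ : T3 → ℝ) (u₀ : T3 → V3), Continuous a₀ → Continuous θ₀ → Continuous u₀ →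
    (∀ x, 0 < a₀ x) → (∀ x, 0 < θ₀ x) → ∃ σ₀ : ℝ, 0 < σ₀ ∧ ∀ σ : ℝ, 0 < σ → σ < σ₀ →
    ∀ (T : ℝ) (ρ θ : ℝ → T3 → ℝ) (u : ℝ → T3 → V3), IsHardSphereEulerSolution σ T ρ u θ →
    ∀ Φ : (N : ℕ) → Flow σ N,
    TendstoHydroFieldsAt (fun N => localGibbsLaw σ a₀ u₀ θ₀ N (Φ N)) Φ ρ u θ 0 →
    ∀ t ∈ Set.Ico 0 T, ∀ yc : ℝ, 0 < yc → yc * σ ^ 3 ≤ 1 → ∀ yk : ℝ, 0 < yk →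
    ∃ V₀ : ℝ, 0 < V₀ ∧ ∀ V : ℝ, V₀ ≤ V → ∀ Θ : ℝ, 0 < Θ → ∀ K : ℕ,
    ∀ η : ℝ, 0 < η → ∃ τ₀ : ℝ, 0 < τ₀ ∧ ∀ τ : ℝ, τ₀ ≤ τ → ∃ N₀ : ℕ, ∀ N : ℕ, N₀ ≤ N → ∀ s ∈ Set.Icc 0 t,
      AEMeasurable (fun z => ∑ i : Fin (N + 1), tailFn V (uncAct₂ Θ yc yk K (Φ N) τ s i z))
          (localGibbsLaw σ a₀ u₀ θ₀ N (Φ N)) ∧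
      ∫⁻ z, ENNReal.ofReal (((N : ℝ) + 1)⁻¹ * ∑ i : Fin (N + 1), tailFn V (uncAct₂ Θ yc yk K (Φ N) τ s i z))
        ∂(localGibbsLaw σ a₀ u₀ θ₀ N (Φ N)) ≤ ENNReal.ofReal η

/-- **TAGGED COLD ACTIVITY SMALL IN MEAN on the horizon `t`, two thresholds**: there are a count threshold `yc` in the dense-phase range
`yc σ³ ≤ 1` and a kinetic threshold `yk` such that for every cold cap `Θ` and accuracy `η` some minimal scale `K` gives, for every
`τ > 0`, `N ≥ N₀(τ)` and all starts `s ≤ t`, `E_{λ₀}[(N+1)⁻¹ Σ_i tagAct₂_i] ≤ η`. -/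
def TaggedSmallOn₂ (σ : ℝ) (a₀ θ₀ : T3 → ℝ) (u₀ : T3 → V3) (Φ : (N : ℕ) → Flow σ N) (t : ℝ) : Prop :=
  ∃ yc : ℝ, 0 < yc ∧ yc * σ ^ 3 ≤ 1 ∧ ∃ yk : ℝ, 0 < yk ∧ ∀ Θ : ℝ, 0 < Θ → ∀ η : ℝ, 0 < η →
    ∃ K : ℕ, ∀ τ : ℝ, 0 < τ → ∃ N₀ : ℕ, ∀ N : ℕ, N₀ ≤ N → ∀ s ∈ Set.Icc 0 t,
      ∫⁻ z, ENNReal.ofReal (((N : ℝ) + 1)⁻¹ * ∑ i : Fin (N + 1), tagAct₂ Θ yc yk K (Φ N) τ s i z)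
        ∂(localGibbsLaw σ a₀ u₀ θ₀ N (Φ N)) ≤ ENNReal.ofReal η

/-- **TAGGED HALF FROM A DILUTE ENVELOPE, LOCALLY, two thresholds** — typed against the TEMPERATURE-FREE diluteness clause
`C (2π/β)^{3/2} σ³ ≤ κ₅` (the count series needs `yc ≥ 100 A`, `A = C(2π/β)^{3/2}`, and `yc σ³ ≤ 1`; the kinetic series runs at
`yk = 200 A β⁻¹`, free). -/
def TaggedFromEnvelope₂ : Prop :=
  ∀ (a₀ θ₀ : T3 → ℝ) (u₀ : T3 → V3), Continuous a₀ → Continuous θ₀ → Continuous u₀ →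
    (∀ x, 0 < a₀ x) → (∀ x, 0 < θ₀ x) → ∃ κ₅ : ℝ, 0 < κ₅ ∧ ∃ σ₅ : ℝ, 0 < σ₅ ∧ ∀ σ : ℝ, 0 < σ → σ < σ₅ →
    ∀ (Φ : (N : ℕ) → Flow σ N) (t t₁ β C : ℝ), 0 ≤ t → t < t₁ → 0 < β → 0 ≤ C →
      C * (2 * Real.pi / β) ^ (3 / 2 : ℝ) * σ ^ 3 ≤ κ₅ →
      EnvelopeOn σ a₀ θ₀ u₀ Φ t₁ β C → TaggedSmallOn₂ σ a₀ θ₀ u₀ Φ t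

/-- **The abnormal-mean bound for ONE profile triple / diameter / flow family on the horizon `t`, two thresholds**: the delivered count
threshold lies in the dense-phase range `yc σ³ ≤ 1`. -/
def AbnormalSmallOn₂ (σ : ℝ) (a₀ θ₀ : T3 → ℝ) (u₀ : T3 → V3) (Φ : (N : ℕ) → Flow σ N) (t : ℝ) : Prop :=
  ∃ yc : ℝ, 0 < yc ∧ yc * σ ^ 3 ≤ 1 ∧ ∃ yk : ℝ, 0 < yk ∧ ∀ η : ℝ, 0 < η →
    ∃ Θ : ℝ, 0 < Θ ∧ ∃ K : ℕ, ∀ τ : ℝ, 0 < τ → ∃ N₀ : ℕ, ∀ N : ℕ, N₀ ≤ N → ∀ s ∈ Set.Icc 0 t,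
      ∫⁻ z, ENNReal.ofReal (((N : ℝ) + 1)⁻¹ *
          ∑ i : Fin (N + 1), (tagAct₂ Θ yc yk K (Φ N) τ s i z + hotAct Θ (Φ N) τ s i z))
        ∂(localGibbsLaw σ a₀ u₀ θ₀ N (Φ N)) ≤ ENNReal.ofReal η

/-- `AbnormalActivityVanishes`, two thresholds: in the crux frame, for every `t < T`, `AbnormalSmallOn₂` on the horizon `t`. -/
def AbnormalActivityVanishes₂' : Prop :=
  ∀ (a₀ θ₀ : T3 → ℝ) (u₀ : T3 → V3), Continuous a₀ → Continuous θ₀ → Continuous u₀ →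
    (∀ x, 0 < a₀ x) → (∀ x, 0 < θ₀ x) → ∃ σ₀ : ℝ, 0 < σ₀ ∧ ∀ σ : ℝ, 0 < σ → σ < σ₀ →
    ∀ (T : ℝ) (ρ θ : ℝ → T3 → ℝ) (u : ℝ → T3 → V3), IsHardSphereEulerSolution σ T ρ u θ →
    ∀ Φ : (N : ℕ) → Flow σ N,
    TendstoHydroFieldsAt (fun N => localGibbsLaw σ a₀ u₀ θ₀ N (Φ N)) Φ ρ u θ 0 →
    ∀ t ∈ Set.Ico 0 T, AbnormalSmallOn₂ σ a₀ θ₀ u₀ Φ t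

/-- **ABNORMAL ACTIVITY FROM A DILUTE ENVELOPE, LOCALLY, two thresholds** (temperature-free clause `C (2π/β)^{3/2} σ³ ≤ κ₅`). -/
def AbnormalFromEnvelope₂ : Prop :=
  ∀ (a₀ θ₀ : T3 → ℝ) (u₀ : T3 → V3), Continuous a₀ → Continuous θ₀ → Continuous u₀ →
    (∀ x, 0 < a₀ x) → (∀ x, 0 < θ₀ x) → ∃ κ₅ : ℝ, 0 < κ₅ ∧ ∃ σ₅ : ℝ, 0 < σ₅ ∧ ∀ σ : ℝ, 0 < σ → σ < σ₅ →
    ∀ (Φ : (N : ℕ) → Flow σ N) (t t₁ β C : ℝ), 0 ≤ t → t < t₁ → 0 < β → 0 ≤ C →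
      C * (2 * Real.pi / β) ^ (3 / 2 : ℝ) * σ ^ 3 ≤ κ₅ →
      EnvelopeOn σ a₀ θ₀ u₀ Φ t₁ β C → AbnormalSmallOn₂ σ a₀ θ₀ u₀ Φ t

/-- **STUB 4'' — PRE-SHOCK ENVELOPE WITH DILUTE CONSTANTS, temperature-free clause** (the line's import in v12; conjecture-grade,
13677-kind). For every `κ > 0`, once `σ` is small: in the crux's pre-shock frame, for every `t < T`, an envelope on `[0, t]` with
constants satisfying `C (2π/β)^{3/2} σ³ ≤ κ`. WEAKER than v4–v11's `PreShockEnvelopeDilute` (no `max 1 β⁻¹`). What the clause says: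
`C(2π/β)^{3/2}` dominates the sup of the spatial one-particle density, so the clause is "the solution stays `κ`-dilute on `[0,t]` for
`σ < σ₀(κ)`" — true for bounded-compression (shock-forming) data, exposed in the imploding corner of the UNGUARDED crux exactly as the
conjunct's packing guard (D-0032); under the guard-relativised crux it is a hypothesis. At equilibrium `C (2π/β)^{3/2} = 2` (p129630). -/
def PreShockEnvelopeDilute₂ : Prop :=
  ∀ (a₀ θ₀ : T3 → ℝ) (u₀ : T3 → V3), Continuous a₀ → Continuous θ₀ → Continuous u₀ →
    (∀ x, 0 < a₀ x) → (∀ x, 0 < θ₀ x) → ∀ κ : ℝ, 0 < κ → ∃ σ₀ : ℝ, 0 < σ₀ ∧ ∀ σ : ℝ, 0 < σ → σ < σ₀ →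
    ∀ (T : ℝ) (ρ θ : ℝ → T3 → ℝ) (u : ℝ → T3 → V3), IsHardSphereEulerSolution σ T ρ u θ →
    ∀ Φ : (N : ℕ) → Flow σ N,
    TendstoHydroFieldsAt (fun N => localGibbsLaw σ a₀ u₀ θ₀ N (Φ N)) Φ ρ u θ 0 →
    ∀ t ∈ Set.Ico 0 T, ∃ β C : ℝ, 0 < β ∧ 0 ≤ C ∧ C * (2 * Real.pi / β) ^ (3 / 2 : ℝ) * σ ^ 3 ≤ κ ∧
      EnvelopeOn σ a₀ θ₀ u₀ Φ t β C

open scoped Classical in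
/-- **STUB T₂a — THE PER-PAIR ONE-WINDOW BOUND OF THE TAGGED HALF, two thresholds** (closable: the landed `lintegral_tubePair_tagMajor_le`
of `…AbnormalActivityTaggedMajorant` p135132 with the count series run at `yc ≥ 100 A` (`lintegral_tubePair_countScale_le`) and the kinetic
series at `yk ≥ 200 A β⁻¹` (`lintegral_tubePair_kineticScale_le`), cap `2^{-K}`, geometric sum `10 · 2^{-K}`). -/
def TaggedPerPair₂ : Prop :=
  ∀ {N : ℕ} {μ : Measure (Cfg N)} {C β : ℝ}, 0 ≤ C → 0 < β → LabelLawEnvelope μ C β →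
    ∀ {k l : Fin (N + 1)}, k ≠ l → ∀ {S : V3 → Set V3}, MeasurableSet {q : V3 × V3 | q.1 ∈ S q.2} →
    ∀ {ε h : ℝ}, 0 ≤ 4 * ε ^ 2 * h → (∀ u, volume (S u) ≤ ENNReal.ofReal (4 * ε ^ 2 * h * ‖u‖)) →
    1 ≤ C * (2 * Real.pi / β) ^ (3 / 2 : ℝ) →
    ∀ {yc : ℝ}, 100 * (C * (2 * Real.pi / β) ^ (3 / 2 : ℝ)) ≤ yc →
    ∀ {yk : ℝ}, 200 * (C * (2 * Real.pi / β) ^ (3 / 2 : ℝ)) * β⁻¹ ≤ yk →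
    ∀ {K : ℕ}, 1 ≤ K → ∀ {δ : ℝ}, 0 ≤ δ → δ ≤ scaleRadius N 1 → ∀ {U : ℝ}, 0 ≤ U →
    ((N : ℝ≥0∞) + 1) * (1 + ENNReal.ofReal C * ENNReal.ofReal ((2 * Real.pi / (β / 2)) ^ (3 / 2 : ℝ))) *
        ENNReal.ofReal (Real.exp (-(β / 4 * U ^ 2))) ≤ 2⁻¹ ^ K →
    ∫⁻ w, tubePair S (w k) (w l) *
        ((if ∃ j, U < ‖(w j).2‖ then 1 else 0) + (if TaggedPlus₂ yc yk δ K w k then 1 else 0)) ∂μ ≤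
      11 * 2⁻¹ ^ K * (ENNReal.ofReal (C ^ 2) * (ENNReal.ofReal (4 * ε ^ 2 * h) * fluxJ β))

/-- **HELPER RUNG R₂ — THE ZERO-DRIFT EQUILIBRIUM RUNG OF THE CRUX for every horizon and start** (the conclusion of c6-0's landed
`stub_equilibriumAllStarts`, p142075): constant profiles `(a₀, 0, θ₀)`, the tail functional of the FULL activity. -/
def EquilibriumZeroDriftRung : Prop :=
  ∀ (a₀ θ₀ : ℝ), 0 < a₀ → 0 < θ₀ → ∃ σ₀ : ℝ, 0 < σ₀ ∧ ∀ σ : ℝ, 0 < σ → σ < σ₀ →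
    ∀ (Φ : (N : ℕ) → Flow σ N) (t : ℝ), 0 ≤ t → ∃ V₀ : ℝ, 0 < V₀ ∧ ∀ V : ℝ, V₀ ≤ V → ∀ ε : ℝ, 0 < ε →
    ∃ τ₀ : ℝ, 0 < τ₀ ∧ ∀ τ : ℝ, τ₀ ≤ τ → ∃ N₀ : ℕ, ∀ N : ℕ, N₀ ≤ N → ∀ s ∈ Set.Icc 0 t,
      ∫⁻ z, ENNReal.ofReal (((N : ℝ) + 1)⁻¹ * ∑ i : Fin (N + 1), tailFn V (act (Φ N) τ s i z))
        ∂(localGibbsLaw σ (fun _ => a₀) (fun _ => 0) (fun _ => θ₀) N (Φ N)) ≤ ENNReal.ofReal ε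

/-- **HELPER RUNG MB — THE N-UNIFORM EQUILIBRIUM MEAN ACTIVITY BOUND** (Markov rung of 2j₂; closable: on the good set the full activity is
the hot activity at cap `Θ = 0` — cold collisions at relative speed `0` carry no impulse, `imp_le_relSpeed` — and the landed window/flux
inequality behind `hotSmallOn_of_pairEnvelopeOn` (p132340) under the explicit BGSR equilibrium envelope `β = θ₀⁻¹`, `C = 2(2πθ₀)^{-3/2}`
(`envelopeOn_const`, p136703) bounds its mean by `4σ³C² ∫∫ |v-w|² e^{-β(|v|²+|w|²)/2} < ∞`, uniformly in `τ` and `N ≥ N₀(τ)`). -/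
def EquilibriumMeanActivityBound : Prop :=
  ∀ (a₀ θ₀ : ℝ), 0 < a₀ → 0 < θ₀ → ∃ σ₀ : ℝ, 0 < σ₀ ∧ ∀ σ : ℝ, 0 < σ → σ < σ₀ → ∃ M : ℝ, 0 < M ∧
    ∀ τ : ℝ, 0 < τ → ∃ N₀ : ℕ, ∀ N : ℕ, N₀ ≤ N → ∀ (Φ : Flow σ N) (s : ℝ), 0 ≤ s →
      ∫⁻ z, ENNReal.ofReal (((N : ℝ) + 1)⁻¹ * ∑ i : Fin (N + 1), act Φ τ s i z) ∂(gibbs σ a₀ θ₀ N Φ) ≤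
        ENNReal.ofReal M

/-! ## §2 The stubs -/

/-- STUB M₂ (closable port of p137046 `stub_uncActMeasurable`: engine `CfgCollisionSumMeasurable` + clamp/ramp approximation of the
indicators `relSpeed ≤ Θ`, `¬ Tagged₂` with the count ramp at `yc` and the kinetic ramp at `yk`). -/
theorem stub_uncActMeasurableTT : UncActMeasurable₂ := by
  sorry

/-- START SHIFT, proved (as p136939): the summand reads the time only through the record's `time` field, which the impulse ignores;
time-independent marks shift along the flow on the good set (`campbell_collisionPairSum_flow_shift_Ioc`). -/
theorem stub_uncActShiftTT : UncActShift₂ := by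
  intro σ N Φ Θ yc yk K τ s i z hz
  unfold uncAct₂ imp
  simp only [HardSphereCollisionRecord.ofConfig_postVel, HardSphereCollisionRecord.ofConfig_preVel]
  rw [campbell_collisionPairSum_flow_shift_Ioc Φ hz s 0 (0 + window τ N), zero_add, zero_add,
    add_comm (window τ N) s]

/-- The generic lemma — LANDED (p137153), discharged by import (`tailFn` copies agree syntactically). -/
theorem stub_lmgfOfJointTails : LMGFOfJointTails :=
  Summit.AtomisticToContinuum.HydrodynamicLimit.Theorems.CollisionActivityTailsLMGFOfJointTails.stub_lmgfOfJointTails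

/-- STUB 2j₂ (OPEN INPUT of the line; N1-type, equilibrium, activity currency, two thresholds). -/
theorem stub_jointUntaggedTailTT : EquilibriumJointUntaggedTail₂ := by
  sorry

/-- STUB ET₂ — ENTROPY TRANSFER AT TIME ZERO, two thresholds (closable port of p130202/p132950 `stub_entropyTransfer(Dilute)`: reference
`G_N = gibbs σ 1 θ₁`, pointwise `dλ₀/dG_N ≤ Λ^{N+1}` (`exists_canonicalDensity_le_pow_mul`), the change-of-measure inequality
`lintegral_withDensity_le_of_exp_moment` with `γ = (log Λ + 2)/η`, measurability along `λ₀ ≪ G_N`). -/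
theorem stub_entropyTransferTT : EquilibriumUntaggedActivityLMGF₂' → UntaggedActivityTails₂' := by
  sorry

/-- STUB T₂a — the per-pair one-window bound of the tagged half with two thresholds (closable port of p135132 `stub_taggedPerPair`). -/
theorem stub_taggedPerPairTT : TaggedPerPair₂ := by
  sorry

/-- STUB T₂b — THE TAGGED HALF FROM A LABEL-SET ENVELOPE, two thresholds (closable port of p135296 `stub_taggedFromLabelEnvelope` /
`taggedSmallOn_of_labelEnvelopeOn` over T₂a: `κ₅ = 1/100`, `σ₅ = 1/2`, delivered thresholds `yc := 100 A` (so `yc σ³ ≤ 1` IS the clause)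
and `yk := 200 A β⁻¹`; window inequality with the two-threshold tagged mark and majorant, speed cap, swept tubes, `44 σ³ C² J 2^{-K} ≤ η`). -/
theorem stub_taggedFromLabelEnvelopeTT : TaggedPerPair₂ → LabelEnvelopeFromEnvelope → TaggedFromEnvelope₂ := by
  sorry

/-- STUB 4'' (IMPORT, conjecture-grade, 13677-kind with the temperature-free dilute clause). -/
theorem stub_preShockEnvelopeDiluteTT : PreShockEnvelopeDilute₂ := by
  sorry

/-- HELPER RUNG R₂ (closable port of p136703/p137111/p142075 `…EquilibriumRung` with two thresholds: BGSR envelope `envelopeOn_const`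
gives the clause `2σ³ ≤ κ₅` — temperature-free now —, the local composition on a horizon, frame hypotheses discharged at constant data by
`isHardSphereEulerSolution_const` / `constantProfileLLN_holds`). Hypotheses: the abnormal branch from an envelope, the entropy transfer, the LMGF. -/
theorem stub_equilibriumRungTT : AbnormalFromEnvelope₂ → (EquilibriumUntaggedActivityLMGF₂' → UntaggedActivityTails₂') →
    EquilibriumUntaggedActivityLMGF₂' → EquilibriumZeroDriftRung := by
  sorry

/-- HELPER RUNG MB (closable): the `N`-uniform equilibrium mean activity bound. -/
theorem stub_equilibriumMeanActivity : EquilibriumMeanActivityBound := by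
  sorry

section LMGFAssembly

/-- `tailFn V = 𝟙_{(V, ∞)} · id` is measurable. -/
theorem measurable_tailFn' (V : ℝ) : Measurable (tailFn V) := by
  show Measurable fun y : ℝ => Set.indicator {y : ℝ | V < y} (fun y => y) y
  exact measurable_id.indicator (measurableSet_lt measurable_const measurable_id)

/-- **Rate bookkeeping** for the assembly: with `A = 2 p e^γ / δ` and any `ρ ≥ max 1 ((A + 1)/V₀)`, for `V ≥ V₀ > 0`,
`p e^γ e^{-ρ V} / (1 - e^{-ρ}) ≤ δ`. -/
theorem rate_bookkeeping {p γ δ V₀ V ρ : ℝ} (hp : 0 ≤ p) (hδ : 0 < δ) (hV₀ : 0 < V₀) (hV : V₀ ≤ V)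
    (hρ1 : 1 ≤ ρ) (hρA : (2 * p * Real.exp γ / δ + 1) / V₀ ≤ ρ) :
    p * Real.exp γ * Real.exp (-(ρ * V)) / (1 - Real.exp (-ρ)) ≤ δ := by
  set A : ℝ := 2 * p * Real.exp γ / δ with hA
  have hA0 : 0 ≤ A := by positivity
  have hD : (1 : ℝ) / 2 ≤ 1 - Real.exp (-ρ) := by
    have h1 : Real.exp (-ρ) ≤ Real.exp (-1) := Real.exp_le_exp.2 (by linarith)
    have h2 : Real.exp (-1) ≤ 1 / 2 := by
      rw [Real.exp_neg]
      have he : (2 : ℝ) ≤ Real.exp 1 := by linarith [Real.add_one_le_exp (1 : ℝ)]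
      rw [inv_eq_one_div]
      exact one_div_le_one_div_of_le (by norm_num) he
    linarith
  have hρV : A + 1 ≤ ρ * V := by
    calc A + 1 = (A + 1) / V₀ * V₀ := by field_simp
      _ ≤ ρ * V₀ := mul_le_mul_of_nonneg_right hρA hV₀.le
      _ ≤ ρ * V := mul_le_mul_of_nonneg_left hV (by linarith)
  have hexp : Real.exp (-(ρ * V)) ≤ (A + 2)⁻¹ := by
    have h1 : Real.exp (-(ρ * V)) ≤ Real.exp (-(A + 1)) := Real.exp_le_exp.2 (by linarith)
    have h2 : Real.exp (-(A + 1)) ≤ (A + 2)⁻¹ := by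
      rw [Real.exp_neg]
      refine inv_anti₀ (by positivity) ?_
      linarith [Real.add_one_le_exp (A + 1)]
    exact h1.trans h2
  have hN : p * Real.exp γ * Real.exp (-(ρ * V)) ≤ p * Real.exp γ * (A + 2)⁻¹ :=
    mul_le_mul_of_nonneg_left hexp (by positivity)
  have hkey : p * Real.exp γ * (A + 2)⁻¹ = (δ / 2) * (A / (A + 2)) := by
    rw [hA]
    field_simp
  have hfrac : A / (A + 2) ≤ 1 := (div_le_one (by positivity)).2 (by linarith)
  have hN' : p * Real.exp γ * Real.exp (-(ρ * V)) ≤ δ / 2 := by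
    rw [hkey] at hN
    nlinarith
  have hDpos : 0 < 1 - Real.exp (-ρ) := by linarith
  rw [div_le_iff₀ hDpos]
  nlinarith

/-- **THE ASSEMBLY** (ported from v10/v11 to two thresholds): the generic lemma, measurability, the start shift and the joint
untagged tail give `EquilibriumUntaggedActivityLMGF₂'`. -/
theorem lmgf_assembly (hG : LMGFOfJointTails) (hM : UncActMeasurable₂) (hS : UncActShift₂)
    (hJ : EquilibriumJointUntaggedTail₂) : EquilibriumUntaggedActivityLMGF₂' := by
  intro a₀ θ₀ ha hθ
  obtain ⟨σ₁, hσ₁, hJ⟩ := hJ a₀ θ₀ ha hθ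
  refine ⟨min σ₁ 2⁻¹, lt_min hσ₁ (by norm_num), fun σ hσ hσlt yc hyc hycσ yk hyk => ?_⟩
  have hσ₁' : σ < σ₁ := hσlt.trans_le (min_le_left _ _)
  have hσ2 : σ ≤ 1 / 2 := (hσlt.trans_le (min_le_right _ _)).le.trans (by norm_num)
  obtain ⟨V₀, hV₀, hJ⟩ := hJ σ hσ hσ₁' yc hyc hycσ yk hyk
  refine ⟨V₀, hV₀, fun V hV Θ hΘ K γ hγ δ hδ => ?_⟩
  obtain ⟨p, hp, hJ⟩ := hJ Θ hΘ K
  set ρ : ℝ := max 1 ((2 * p * Real.exp γ / δ + 1) / V₀) with hρ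
  have hρ1 : 1 ≤ ρ := le_max_left _ _
  obtain ⟨τ₀, hτ₀, hJ⟩ := hJ (γ + ρ) (by linarith)
  refine ⟨τ₀, hτ₀, fun τ hτ => ?_⟩
  obtain ⟨N₀, hJ⟩ := hJ τ hτ
  refine ⟨N₀, fun N hN Φ s _hs => ?_⟩
  set G := gibbs σ a₀ θ₀ N Φ with hGdef
  haveI : IsProbabilityMeasure G :=
    isProbabilityMeasure_localGibbsLaw continuous_const continuous_const continuous_const
      (fun _ => ha) (fun _ => hθ) hσ2 N Φ
  have hgood : ∀ᵐ z ∂G, z ∈ Φ.good := ae_mem_good_localGibbsLaw σ _ _ _ N Φ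
  have hpres : MeasurePreserving (Φ.flow s) G G :=
    Summit.AtomisticToContinuum.HydrodynamicLimit.Theorems.measurePreserving_flow_localGibbsLaw_const σ a₀ θ₀ 0 N Φ s
  set F : Fin (N + 1) → Cfg N → ℝ := fun i => Φ.good.indicator fun z => uncAct₂ Θ yc yk K Φ τ 0 i z with hF
  have hFm : ∀ i, Measurable (F i) := fun i => hM σ N Φ Θ yc yk K τ 0 i
  have hae : ∀ᵐ z ∂G, ∀ i, uncAct₂ Θ yc yk K Φ τ s i z = F i (Φ.flow s z) := by
    filter_upwards [hgood] with z hz i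
    rw [hS σ N Φ Θ yc yk K τ s i z hz]
    exact (Set.indicator_of_mem (Φ.mapsTo_good s hz) _).symm
  have hsum_ae : ∀ᵐ z ∂G, (∑ i, tailFn V (uncAct₂ Θ yc yk K Φ τ s i z)) = ∑ i, tailFn V (F i (Φ.flow s z)) := by
    filter_upwards [hae] with z hz
    exact Finset.sum_congr rfl fun i _ => by rw [hz i]
  have hmeasSum : Measurable fun z => ∑ i, tailFn V (F i z) :=
    Finset.measurable_sum _ fun i _ => (measurable_tailFn' V).comp (hFm i)
  constructor
  · refine (hmeasSum.comp (Φ.measurable_flow s)).aemeasurable.congr ?_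
    filter_upwards [hsum_ae] with z hz
    exact hz.symm
  · have hq : p * Real.exp γ * Real.exp (-((γ + ρ - γ) * V)) / (1 - Real.exp (-(γ + ρ - γ))) ≤ δ := by
      rw [show γ + ρ - γ = ρ by ring]
      exact rate_bookkeeping hp hδ hV₀ hV hρ1 (le_max_right _ _)
    have hmeas : Measurable fun z => ENNReal.ofReal (Real.exp (γ * ∑ i, tailFn V (F i z))) :=
      ENNReal.measurable_ofReal.comp (Real.measurable_exp.comp (hmeasSum.const_mul γ))
    calc ∫⁻ z, ENNReal.ofReal (Real.exp (γ * ∑ i, tailFn V (uncAct₂ Θ yc yk K Φ τ s i z))) ∂G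
        = ∫⁻ z, ENNReal.ofReal (Real.exp (γ * ∑ i, tailFn V (F i (Φ.flow s z)))) ∂G := by
          refine lintegral_congr_ae ?_
          filter_upwards [hsum_ae] with z hz
          rw [hz]
      _ = ∫⁻ z, ENNReal.ofReal (Real.exp (γ * ∑ i, tailFn V (F i z))) ∂G := hpres.lintegral_comp hmeas
      _ ≤ ENNReal.ofReal (Real.exp (((N + 1 : ℕ) : ℝ) *
            (p * Real.exp γ * Real.exp (-((γ + ρ - γ) * V)) / (1 - Real.exp (-(γ + ρ - γ)))))) := by
          refine hG (Cfg N) G (N + 1) F (fun i => (hFm i).aemeasurable) V p (γ + ρ) γ hp hγ (by linarith) ?_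
          intro S m
          refine le_trans (measure_mono_ae ?_) (hJ N hN Φ S m V hV)
          filter_upwards [hgood] with z hz h i hi
          have h' := h i hi
          simp only [hF, Set.indicator_of_mem hz] at h'
          exact h'
      _ ≤ ENNReal.ofReal (Real.exp (δ * ((N : ℝ) + 1))) := by
          refine ENNReal.ofReal_le_ofReal (Real.exp_le_exp.2 ?_)
          push_cast
          rw [mul_comm δ]
          exact mul_le_mul_of_nonneg_left hq (by positivity)

end LMGFAssembly

/-- The untagged LMGF₂ is assembled from the generic lemma (landed), M₂, the start shift (proved) and the open input 2j₂. -/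
theorem untaggedLMGF_of_stubs : EquilibriumUntaggedActivityLMGF₂' :=
  lmgf_assembly stub_lmgfOfJointTails stub_uncActMeasurableTT stub_uncActShiftTT stub_jointUntaggedTailTT

/-! ### The abnormal branch: reduction to the two halves (ported from p132104) -/

section AbnormalReduction

variable {σ : ℝ} {N : ℕ}

/-- The impulse is nonnegative. -/
theorem imp_nonneg (y : Cfg N) (t : ℝ) (k l : Fin (N + 1)) : 0 ≤ imp σ N y t k l := norm_nonneg _

/-- The untagged cold activity is nonnegative (`σ, τ ≥ 0`). -/
theorem uncAct₂_nonneg (hσ : 0 ≤ σ) {Θ yc yk : ℝ} {K : ℕ} (Φ : Flow σ N) {τ : ℝ} (hτ : 0 ≤ τ) (s : ℝ)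
    (i : Fin (N + 1)) (z : Cfg N) : 0 ≤ uncAct₂ Θ yc yk K Φ τ s i z := by
  classical
  unfold uncAct₂
  refine mul_nonneg (div_nonneg hσ hτ) (collisionPairSum_nonneg Φ _ (fun t cfg k l => ?_) z)
  split_ifs
  · exact imp_nonneg _ _ _ _
  · exact le_rfl

/-- The tagged cold activity is nonnegative (`σ, τ ≥ 0`). -/
theorem tagAct₂_nonneg (hσ : 0 ≤ σ) {Θ yc yk : ℝ} {K : ℕ} (Φ : Flow σ N) {τ : ℝ} (hτ : 0 ≤ τ) (s : ℝ)
    (i : Fin (N + 1)) (z : Cfg N) : 0 ≤ tagAct₂ Θ yc yk K Φ τ s i z := by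
  classical
  unfold tagAct₂
  refine mul_nonneg (div_nonneg hσ hτ) (collisionPairSum_nonneg Φ _ (fun t cfg k l => ?_) z)
  split_ifs
  · exact imp_nonneg _ _ _ _
  · exact le_rfl

/-- The hot activity is nonnegative (`σ, τ ≥ 0`). -/
theorem hotAct_nonneg (hσ : 0 ≤ σ) {Θ : ℝ} (Φ : Flow σ N) {τ : ℝ} (hτ : 0 ≤ τ) (s : ℝ)
    (i : Fin (N + 1)) (z : Cfg N) : 0 ≤ hotAct Θ Φ τ s i z := by
  classical
  unfold hotAct
  refine mul_nonneg (div_nonneg hσ hτ) (collisionPairSum_nonneg Φ _ (fun t cfg k l => ?_) z)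
  split_ifs
  · exact imp_nonneg _ _ _ _
  · exact le_rfl

variable {a₀ θ₀ : T3 → ℝ} {u₀ : T3 → V3} {Φf : (N : ℕ) → Flow σ N} {t : ℝ}

/-- **REDUCTION on a horizon, two thresholds** (ported from `abnormalSmallOn_of_hot_of_tagged`, p132104): the hot half and the tagged
half give `AbnormalSmallOn₂` (`(yc, yk)` from the tagged half; `Θ` from the hot half at `η/2`; `K` from the tagged half at `(Θ, η/2)`;
`N₀ = max`; one `lintegral` split by the measurable hot majorant). -/
theorem abnormalSmallOn₂_of_hot_of_tagged (hσ : 0 ≤ σ) (hH : HotSmallOn σ a₀ θ₀ u₀ Φf t)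
    (hT : TaggedSmallOn₂ σ a₀ θ₀ u₀ Φf t) : AbnormalSmallOn₂ σ a₀ θ₀ u₀ Φf t := by
  obtain ⟨yc, hyc, hycσ, yk, hyk, hT⟩ := hT
  refine ⟨yc, hyc, hycσ, yk, hyk, fun η hη => ?_⟩
  have hη2 : 0 < η / 2 := by positivity
  obtain ⟨Θ, hΘ, hH⟩ := hH (η / 2) hη2
  obtain ⟨K, hT⟩ := hT Θ hΘ (η / 2) hη2
  refine ⟨Θ, hΘ, K, fun τ hτ => ?_⟩
  obtain ⟨N₁, hH⟩ := hH τ hτ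
  obtain ⟨N₂, hT⟩ := hT τ hτ
  refine ⟨max N₁ N₂, fun N hN s hs => ?_⟩
  obtain ⟨g, hgm, hdom, hHb⟩ := hH N (le_of_max_le_left hN) s hs
  have hTb := hT N (le_of_max_le_right hN) s hs
  set P := localGibbsLaw σ a₀ u₀ θ₀ N (Φf N) with hP
  have hN1 : (0 : ℝ) ≤ ((N : ℝ) + 1)⁻¹ := inv_nonneg.2 (by positivity)
  have hae : ∀ᵐ z ∂P, ENNReal.ofReal (((N : ℝ) + 1)⁻¹ *
      ∑ i : Fin (N + 1), (tagAct₂ Θ yc yk K (Φf N) τ s i z + hotAct Θ (Φf N) τ s i z)) ≤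
      ENNReal.ofReal (((N : ℝ) + 1)⁻¹ * ∑ i : Fin (N + 1), tagAct₂ Θ yc yk K (Φf N) τ s i z) + g z := by
    filter_upwards [hdom] with z hz
    rw [Finset.sum_add_distrib, mul_add, ENNReal.ofReal_add
      (mul_nonneg hN1 (Finset.sum_nonneg fun i _ => tagAct₂_nonneg hσ (Φf N) hτ.le s i z))
      (mul_nonneg hN1 (Finset.sum_nonneg fun i _ => hotAct_nonneg hσ (Φf N) hτ.le s i z))]
    exact add_le_add le_rfl hz
  calc _ ≤ ∫⁻ z, ENNReal.ofReal (((N : ℝ) + 1)⁻¹ * ∑ i : Fin (N + 1), tagAct₂ Θ yc yk K (Φf N) τ s i z) + g z ∂P :=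
        lintegral_mono_ae hae
    _ = ∫⁻ z, ENNReal.ofReal (((N : ℝ) + 1)⁻¹ * ∑ i : Fin (N + 1), tagAct₂ Θ yc yk K (Φf N) τ s i z) ∂P +
          ∫⁻ z, g z ∂P := lintegral_add_right' _ hgm.aemeasurable
    _ ≤ ENNReal.ofReal (η / 2) + ENNReal.ofReal (η / 2) := add_le_add hTb hHb
    _ = ENNReal.ofReal η := by rw [← ENNReal.ofReal_add hη2.le hη2.le, add_halves]

end AbnormalReduction

/-- **REDUCTION of the local abnormal statement to its two halves, two thresholds** (ported from
`stub_abnormalFromEnvelope_of_hot_of_tagged`, p132104): `κ₅` from the tagged half, `σ₅ = min`. -/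
theorem abnormalFromEnvelope₂_of_hot_of_tagged : HotFromEnvelope → TaggedFromEnvelope₂ → AbnormalFromEnvelope₂ := by
  intro hH hT a₀ θ₀ u₀ ha hθ hu ha0 hθ0
  obtain ⟨σ₁, hσ₁, hH⟩ := hH a₀ θ₀ u₀ ha hθ hu ha0 hθ0
  obtain ⟨κ₅, hκ₅, σ₂, hσ₂, hT⟩ := hT a₀ θ₀ u₀ ha hθ hu ha0 hθ0
  refine ⟨κ₅, hκ₅, min σ₁ σ₂, lt_min hσ₁ hσ₂, fun σ hσ hσlt Φ t t₁ β C ht htt₁ hβ hC hdil hE => ?_⟩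
  exact abnormalSmallOn₂_of_hot_of_tagged hσ.le
    (hH σ hσ (hσlt.trans_le (min_le_left _ _)) Φ t t₁ β C ht htt₁ hβ hC hE)
    (hT σ hσ (hσlt.trans_le (min_le_right _ _)) Φ t t₁ β C ht htt₁ hβ hC hdil hE)

/-- The HOT half is LANDED (p132340 `hotFromEnvelope_of_pairEnvelope` + plumbing p131788 `stub_labelEnvelopeOn`). -/
theorem hotFromEnvelope_holds : HotFromEnvelope :=
  hotFromEnvelope_of_pairEnvelope fun a₀ θ₀ u₀ ha hθ hu ha0 hθ0 σ hσ hσ2 Φ t₁ β C hC hE =>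
    (stub_labelEnvelopeOn a₀ θ₀ u₀ ha hθ hu ha0 hθ0 σ hσ hσ2 Φ t₁ β C hC hE).2

/-- **STUB 5₂ — a THEOREM modulo T₂a/T₂b**: hot half (landed) + tagged half (T₂b over T₂a and the landed plumbing) + the reduction. -/
theorem stub_abnormalFromEnvelopeTT : AbnormalFromEnvelope₂ :=
  abnormalFromEnvelope₂_of_hot_of_tagged hotFromEnvelope_holds
    (stub_taggedFromLabelEnvelopeTT stub_taggedPerPairTT stub_labelEnvelopeOn)

/-- The local stub 5₂ and the import 4'' give the global abnormal statement (`t₁ := (t + T)/2`). -/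
theorem abnormalActivityVanishes₂'_of_local (h5 : AbnormalFromEnvelope₂) (h4 : PreShockEnvelopeDilute₂) :
    AbnormalActivityVanishes₂' := by
  intro a₀ θ₀ u₀ ha hθ hu ha0 hθ0
  obtain ⟨κ₅, hκ₅, σ₅, hσ₅, h5⟩ := h5 a₀ θ₀ u₀ ha hθ hu ha0 hθ0
  obtain ⟨σ₄, hσ₄, h4⟩ := h4 a₀ θ₀ u₀ ha hθ hu ha0 hθ0 κ₅ hκ₅
  refine ⟨min σ₄ σ₅, lt_min hσ₄ hσ₅, fun σ hσ hσlt T ρ θ u hsol Φ hLLN t ht => ?_⟩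
  have hσ₄' : σ < σ₄ := hσlt.trans_le (min_le_left _ _)
  have hσ₅' : σ < σ₅ := hσlt.trans_le (min_le_right _ _)
  have ht₁ : (t + T) / 2 ∈ Set.Ico 0 T := ⟨by linarith [ht.1, ht.2], by linarith [ht.2]⟩
  obtain ⟨β, C, hβ, hC, hdil, hE⟩ := h4 σ hσ hσ₄' T ρ θ u hsol Φ hLLN _ ht₁
  exact h5 σ hσ hσ₅' Φ t ((t + T) / 2) β C ht.1 (by linarith [ht.2]) hβ hC hdil hE

/-! ### The equilibrium rung and the mean bound ride on the registered helper stubs -/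

/-- The zero-drift equilibrium rung of the crux from 2j₂ ALONE (modulo the closable ports R₂, ET₂, M₂, T₂a, T₂b). -/
theorem equilibriumZeroDriftRung_of_stubs : EquilibriumZeroDriftRung :=
  stub_equilibriumRungTT stub_abnormalFromEnvelopeTT stub_entropyTransferTT untaggedLMGF_of_stubs

/-! ## §3 The composition -/

/-- Local alias of the crux (so that exactly one theorem below, `CollisionActivityTails_of`, has the crux decl itself as its conclusion). -/
abbrev Crux : Prop := Summit.AtomisticToContinuum.HydrodynamicLimit.Theses.OneFlightGossipEngine.CollisionActivityTails

section Composition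

variable {σ : ℝ} {N : ℕ}

/-- Pointwise bookkeeping of the split: `[P] x = [P ∧ Q ∧ ¬R] x + [P ∧ Q ∧ R] x + [P ∧ ¬Q] x` (any decidability instances). -/
theorem ite_split3 {P Q R : Prop} [Decidable P] [Decidable (P ∧ Q ∧ ¬ R)] [Decidable (P ∧ Q ∧ R)] [Decidable (P ∧ ¬ Q)]
    (x : ℝ) :
    (if P then x else 0) =
      (if P ∧ Q ∧ ¬ R then x else 0) + (if P ∧ Q ∧ R then x else 0) + (if P ∧ ¬ Q then x else 0) := by
  by_cases hP : P
  · by_cases hQ : Q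
    · by_cases hR : R
      · rw [if_pos hP, if_neg (fun h => h.2.2 hR), if_pos ⟨hP, hQ, hR⟩, if_neg (fun h => h.2 hQ)]; ring
      · rw [if_pos hP, if_pos ⟨hP, hQ, hR⟩, if_neg (fun h => hR h.2.2), if_neg (fun h => h.2 hQ)]; ring
    · rw [if_pos hP, if_neg (fun h => hQ h.2.1), if_neg (fun h => hQ h.2.1), if_pos ⟨hP, hQ⟩]; ring
  · rw [if_neg hP, if_neg (fun h => hP h.1), if_neg (fun h => hP h.1), if_neg (fun h => hP h.1)]; ring

/-- **The collision-by-collision split is exact on the good set**: `a_i = uncAct₂_i + tagAct₂_i + hotAct_i`. -/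
theorem act_eq_uncAct₂_add_tagAct₂_add_hotAct (Θ yc yk : ℝ) (K : ℕ) (Φ : Flow σ N) (τ s : ℝ) (i : Fin (N + 1))
    {z : Cfg N} (hz : z ∈ Φ.good) :
    act Φ τ s i z = uncAct₂ Θ yc yk K Φ τ s i z + tagAct₂ Θ yc yk K Φ τ s i z + hotAct Θ Φ τ s i z := by
  classical
  have hfin : (collisionTimes (Torus.geometry (Fin 3)) (hsDiameter σ N) (fun t => Φ.flow t z) ∩
      Set.Ioc s (s + window τ N)).Finite :=
    Φ.finite_collisionTimes_inter hz Set.Ioc_subset_Icc_self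
  unfold act uncAct₂ tagAct₂ hotAct HardSphereFlow.collisionSum HardSphereFlow.collisionPairSum
    Literature.Analysis.FluidPDE.collisionSum
  rw [← mul_add, ← mul_add, ← collisionPairSum_add hfin, ← collisionPairSum_add hfin]
  congr 1
  unfold Literature.Analysis.FluidPDE.collisionPairSum
  refine finsum_congr fun t => finsum_congr fun _ => Finset.sum_congr rfl fun p _ => ?_
  exact ite_split3 _

/-- Three-term tail algebra with two untailed summands: if `0 ≤ x₁, x₂, x₃` and `a ≤ x₁ + x₂ + x₃` then
`𝟙{V < a} a ≤ 3 (𝟙{V/3 < x₁} x₁ + x₂ + x₃)`. -/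
theorem tailFn_le_three_mul_tail_add {V a x₁ x₂ x₃ : ℝ} (h₁ : 0 ≤ x₁) (h₂ : 0 ≤ x₂) (h₃ : 0 ≤ x₃)
    (ha : a ≤ x₁ + x₂ + x₃) : tailFn V a ≤ 3 * (tailFn (V / 3) x₁ + x₂ + x₃) := by
  by_cases hVa : V < a
  · rw [tailFn_of_lt hVa]
    by_cases hx : V / 3 < x₁
    · rw [tailFn_of_lt hx]
      linarith
    · rw [tailFn_of_le (not_lt.1 hx)]
      linarith [not_lt.1 hx]
  · rw [tailFn_of_le (not_lt.1 hVa)]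
    have := tailFn_nonneg (V := V / 3) h₁
    positivity

/-- Pathwise tail algebra on the good set: `𝟙{V < a_i} a_i ≤ 3 (𝟙{V/3 < unc_i} unc_i + tag_i + hot_i)`. -/
theorem tailFn_act_le_three (hσ : 0 ≤ σ) {Θ yc yk : ℝ} {K : ℕ} (Φ : Flow σ N) {τ : ℝ} (hτ : 0 ≤ τ) (s : ℝ)
    (i : Fin (N + 1)) {z : Cfg N} (hz : z ∈ Φ.good) (V : ℝ) :
    tailFn V (act Φ τ s i z) ≤
      3 * (tailFn (V / 3) (uncAct₂ Θ yc yk K Φ τ s i z) + tagAct₂ Θ yc yk K Φ τ s i z + hotAct Θ Φ τ s i z) :=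
  tailFn_le_three_mul_tail_add (uncAct₂_nonneg hσ Φ hτ s i z) (tagAct₂_nonneg hσ Φ hτ s i z)
    (hotAct_nonneg hσ Φ hτ s i z) (act_eq_uncAct₂_add_tagAct₂_add_hotAct Θ yc yk K Φ τ s i hz).le

/-- Splitting `∫⁻ ofReal (c (A₁ + A₂))` when `A₁` is a.e.-measurable and `c ≥ 0`. -/
theorem lintegral_ofReal_mul_add_le {α : Type*} [MeasurableSpace α] {μ : Measure α}
    {A₁ A₂ : α → ℝ} {c : ℝ} (hc : 0 ≤ c) (h₁ : AEMeasurable A₁ μ) :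
    ∫⁻ x, ENNReal.ofReal (c * (A₁ x + A₂ x)) ∂μ ≤
      ENNReal.ofReal c * (∫⁻ x, ENNReal.ofReal (A₁ x) ∂μ + ∫⁻ x, ENNReal.ofReal (A₂ x) ∂μ) := by
  have hm₁ : AEMeasurable (fun x => ENNReal.ofReal (A₁ x)) μ := h₁.ennreal_ofReal
  calc ∫⁻ x, ENNReal.ofReal (c * (A₁ x + A₂ x)) ∂μ
      ≤ ∫⁻ x, ENNReal.ofReal c * (ENNReal.ofReal (A₁ x) + ENNReal.ofReal (A₂ x)) ∂μ := by
        refine lintegral_mono fun x => ?_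
        rw [ENNReal.ofReal_mul hc]
        exact mul_le_mul_right ENNReal.ofReal_add_le _
    _ = ENNReal.ofReal c * ∫⁻ x, (ENNReal.ofReal (A₁ x) + ENNReal.ofReal (A₂ x)) ∂μ :=
        lintegral_const_mul' _ _ ENNReal.ofReal_ne_top
    _ = ENNReal.ofReal c * (∫⁻ x, ENNReal.ofReal (A₁ x) ∂μ + ∫⁻ x, ENNReal.ofReal (A₂ x) ∂μ) := by
        rw [lintegral_add_left' hm₁]

/-- **COMPOSITION** — the untagged tail statement and the abnormal-mean statement (two thresholds) imply the crux
`OneFlightGossipEngine.CollisionActivityTails`, concluded BY NAME. Quantifier bookkeeping: `σ₀ = min`; `(yc, yk)` from the abnormal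
branch (its `yc σ³ ≤ 1` feeds the untagged branch's guard); `V₀ := 3 V₀ᵘ(yc, yk)`; given `V, ε`: `Θ, K` from the abnormal branch at
accuracy `ε/9`, then `τ₀` from the untagged branch at level `V/3`, caps `Θ, K`, accuracy `ε/9`; `N₀ = max`; pathwise
`𝟙{V<a}a ≤ 3(tail_{V/3} unc + tag + hot)` a.e., one `lintegral` split, `3(ε/9 + ε/9) ≤ ε`. -/
theorem crux_of_branches : UntaggedActivityTails₂' → AbnormalActivityVanishes₂' → Crux := by
  intro hU hR a₀ θ₀ u₀ ha hθ hu ha0 hθ0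
  obtain ⟨σ₁, hσ₁, hU⟩ := hU a₀ θ₀ u₀ ha hθ hu ha0 hθ0
  obtain ⟨σ₂, hσ₂, hR⟩ := hR a₀ θ₀ u₀ ha hθ hu ha0 hθ0
  refine ⟨min σ₁ σ₂, lt_min hσ₁ hσ₂, ?_⟩
  intro σ hσ hσlt T ρ θ u hsol Φ hLLN t ht
  have hσ₁' : σ < σ₁ := hσlt.trans_le (min_le_left _ _)
  have hσ₂' : σ < σ₂ := hσlt.trans_le (min_le_right _ _)
  obtain ⟨yc, hyc, hycσ, yk, hyk, hR⟩ := hR σ hσ hσ₂' T ρ θ u hsol Φ hLLN t ht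
  obtain ⟨V₀, hV₀, hU⟩ := hU σ hσ hσ₁' T ρ θ u hsol Φ hLLN t ht yc hyc hycσ yk hyk
  refine ⟨3 * V₀, by positivity, ?_⟩
  intro V hV ε hε
  have hε9 : 0 < ε / 9 := by positivity
  obtain ⟨Θ, hΘ, K, hR⟩ := hR (ε / 9) hε9
  obtain ⟨τ₀, hτ₀, hU⟩ := hU (V / 3) (by linarith) Θ hΘ K (ε / 9) hε9
  refine ⟨τ₀, hτ₀, fun τ hτ => ?_⟩
  have hτpos : 0 < τ := hτ₀.trans_le hτ
  obtain ⟨N₁, hU⟩ := hU τ hτ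
  obtain ⟨N₂, hR⟩ := hR τ hτpos
  refine ⟨max N₁ N₂, fun N hN s hs => ?_⟩
  show ∫⁻ z, ENNReal.ofReal (((N : ℝ) + 1)⁻¹ * ∑ i : Fin (N + 1), tailFn V (act (Φ N) τ s i z))
      ∂(localGibbsLaw σ a₀ u₀ θ₀ N (Φ N)) ≤ ENNReal.ofReal ε
  obtain ⟨hmeas, hUb⟩ := hU N (le_of_max_le_left hN) s hs
  have hRb := hR N (le_of_max_le_right hN) s hs
  set P := localGibbsLaw σ a₀ u₀ θ₀ N (Φ N) with hP
  have hN1 : (0 : ℝ) < (N : ℝ) + 1 := by positivity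
  have hae : ∀ᵐ z ∂P,
      ((N : ℝ) + 1)⁻¹ * ∑ i : Fin (N + 1), tailFn V (act (Φ N) τ s i z) ≤
        3 * ((((N : ℝ) + 1)⁻¹ * ∑ i : Fin (N + 1), tailFn (V / 3) (uncAct₂ Θ yc yk K (Φ N) τ s i z)) +
          (((N : ℝ) + 1)⁻¹ * ∑ i : Fin (N + 1),
            (tagAct₂ Θ yc yk K (Φ N) τ s i z + hotAct Θ (Φ N) τ s i z))) := by
    filter_upwards [ae_mem_good_localGibbsLaw σ a₀ θ₀ u₀ N (Φ N)] with z hz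
    have hpt : ∀ i : Fin (N + 1), tailFn V (act (Φ N) τ s i z) ≤
        3 * (tailFn (V / 3) (uncAct₂ Θ yc yk K (Φ N) τ s i z) +
          (tagAct₂ Θ yc yk K (Φ N) τ s i z + hotAct Θ (Φ N) τ s i z)) := fun i => by
      have := tailFn_act_le_three hσ.le (Θ := Θ) (yc := yc) (yk := yk) (K := K) (Φ N) hτpos.le s i hz V
      linarith
    have hsum := Finset.sum_le_sum fun i (_ : i ∈ Finset.univ) => hpt i
    rw [← Finset.mul_sum, Finset.sum_add_distrib] at hsum
    have hinv : 0 ≤ ((N : ℝ) + 1)⁻¹ := inv_nonneg.2 hN1.le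
    have := mul_le_mul_of_nonneg_left hsum hinv
    nlinarith [this]
  have hmeas' : AEMeasurable
      (fun z => ((N : ℝ) + 1)⁻¹ * ∑ i : Fin (N + 1), tailFn (V / 3) (uncAct₂ Θ yc yk K (Φ N) τ s i z)) P :=
    hmeas.const_mul _
  calc ∫⁻ z, ENNReal.ofReal (((N : ℝ) + 1)⁻¹ * ∑ i : Fin (N + 1), tailFn V (act (Φ N) τ s i z)) ∂P
      ≤ ∫⁻ z, ENNReal.ofReal (3 * ((((N : ℝ) + 1)⁻¹ *
            ∑ i : Fin (N + 1), tailFn (V / 3) (uncAct₂ Θ yc yk K (Φ N) τ s i z)) +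
          (((N : ℝ) + 1)⁻¹ * ∑ i : Fin (N + 1),
            (tagAct₂ Θ yc yk K (Φ N) τ s i z + hotAct Θ (Φ N) τ s i z)))) ∂P :=
        lintegral_mono_ae (hae.mono fun z hz => ENNReal.ofReal_le_ofReal hz)
    _ ≤ ENNReal.ofReal 3 * (∫⁻ z, ENNReal.ofReal (((N : ℝ) + 1)⁻¹ *
            ∑ i : Fin (N + 1), tailFn (V / 3) (uncAct₂ Θ yc yk K (Φ N) τ s i z)) ∂P +
          ∫⁻ z, ENNReal.ofReal (((N : ℝ) + 1)⁻¹ * ∑ i : Fin (N + 1),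
            (tagAct₂ Θ yc yk K (Φ N) τ s i z + hotAct Θ (Φ N) τ s i z)) ∂P) :=
        lintegral_ofReal_mul_add_le (by norm_num) hmeas'
    _ ≤ ENNReal.ofReal 3 * (ENNReal.ofReal (ε / 9) + ENNReal.ofReal (ε / 9)) := by
        gcongr
    _ = ENNReal.ofReal (3 * (ε / 9 + ε / 9)) := by
        rw [← ENNReal.ofReal_add hε9.le hε9.le, ← ENNReal.ofReal_mul (by norm_num)]
    _ ≤ ENNReal.ofReal ε := ENNReal.ofReal_le_ofReal (by linarith)

end Composition

/-- **`CollisionActivityTails_of`** — the skeleton concludes the crux BY NAME from the registered stubs (v12: open = 2j₂, 4''; closable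
ports = M₂, ET₂, T₂a, T₂b; proved here = shift, abnormal reduction, LMGF assembly, composition). -/
theorem CollisionActivityTails_of :
    Summit.AtomisticToContinuum.HydrodynamicLimit.Theses.OneFlightGossipEngine.CollisionActivityTails :=
  crux_of_branches (stub_entropyTransferTT untaggedLMGF_of_stubs)
    (abnormalActivityVanishes₂'_of_local stub_abnormalFromEnvelopeTT stub_preShockEnvelopeDiluteTT)

end Summit.AtomisticToContinuum.HydrodynamicLimit.Cruxes.CollisionActivityTails.PlaqueThinningCountLd

end
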